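import Summits.NavierStokesRegularity.FunctionalMining.NoGo.TopEigSaturatingKill
import Summits.NavierStokesRegularity.FunctionalMining.TopEigScaling
import HarnessLib

/-!
# FunctionalMining — LEMMA K in SCALING form: the static door at EVERY FIXED viscosity for the
# one-sided spectral rows `ES.lam1.q | T_LD`, from ONE family with a production floor

Search for candidate a priori estimates; no regularity claim. Cell `pub-nsfunc`, census-2 seat
(gen 41), staged as `pub-nsfunc-census-2/lean/lemmaK-B/TopEigSaturatingKillNu.lean` (sha256
435437f22c64a675, 493 lines) and filed by the prove seat (gen 24) in TWO parts for the 400-line lint: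
§§1–3 (the `λ₁` rows) here, §4 (the `−λ₃` mirror) in `TopEigSaturatingKillNuBot.lean`; declarations
byte-identical to the staged file, same order; import l.1 adjusted to the door's tree name
`NoGo.TopEigSaturatingKill` (filed in two parts, p344559 / p345062).
Imports the no-go seat's staged `TopEigSaturatingKill.lean` (the door `TopEigSelKillAt`, heat-maximal
selections, the selection production `𝒫_q`, Lemma 0 (⇒) + LEMMA S, and LEMMA K in LARGE-VISCOSITY
form, §7 there) and this seat's `TopEigScaling.lean` (homogeneity, the law at one viscosity
`SaturatingLawSupAt`, the arithmetic core `exists_scale_budget_lt_of_family`). Refutation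
BOOKKEEPING for CANDIDATE a priori inequalities; nothing about regularity; NO witness family is
exhibited (the hypotheses (K-a)–(K-c) below are what a pen family — the no-go seat's W18 / (F1) —
must supply), and no row verdict is a kernel theorem by this file.

The large-viscosity LEMMA K of `TopEigSaturatingKill.lean` (`topEigSelKill_of_family`) opens the door
`TopEigSelKillAt q σ γ κ` for every `κ` by taking `ν` LARGE; it needs `γ > 0` and says nothing at a
GIVEN viscosity. The pen LEMMA K (QN4-NOTE §2; SELKILL-NOTE §2 (D2); SELKILL-NOTE-ADD1 §A1.2: "the law
fails at EVERY fixed `ν > 0`") uses instead the amplitude scaling `w ↦ a • w`, under which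
(`TopEigScaling.lean`, and §1 here) the budget scales like `a^{2+q(1+1/σ)}`, the selection production
like `a^{q+1}` (`TopEig.selEulerProduction_smul`: `E_{a w} = a² E_w`, `λ₁ ↦ a λ₁`, heat-maximal
selections are preserved, `TopEig.IsHeatMaxSelection.smul`) and the heat cost like `a^q`. Hence
(§2) for `1 + q/σ > 0` — and WITHOUT any sign condition on `γ` — a family of smooth divergence-free
zero-mean data on `T³` with heat-maximal selections and
(K-a) a production floor `0 < c ≤ 𝒫_q(w i; e i)`, (K-b) bounded budgets
`(2ℰ(w i)) Φ_q(w i)^{1+1/σ} ≤ B`, (K-c) heat costs `heatDissipation Φ_q (w i) ≤ ε` for every `ε > 0`,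
opens the FIXED-VISCOSITY door `TopEigSelKillAtNu q σ γ κ ν` for EVERY real `κ` and EVERY `ν > 0`
(`topEigSelKillAtNu_of_family`: amplitude first, member second), so that (§3, Lemma 0 (⇒) at one
viscosity, `SaturatingLawSupAt.selEulerProduction_sub_heat_le`) the law `SaturatingLawSupAt ν Φ_q σ γ κ`
fails at every `ν > 0` and every `κ` for `q ≥ 1` (`not_topEigMoment_saturatingLawSupAt_of_family`), and
in particular `TopEigSelKill q σ γ` and `∀ κ, ¬ SaturatingLawSup Φ_q σ γ κ` hold without `γ > 0`
(`topEigSelKill_of_family_of_scaling`, `not_topEigMoment_saturatingLawSup_of_family_of_scaling`).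
[ours, bookkeeping; QN4-NOTE LEMMA K (scaling form), SIEVELD §0 Lemma 0 (⇒)]
-/

noncomputable section

open MeasureTheory Set Filter Topology

namespace Summit.NavierStokesRegularity.FunctionalMining

open Literature.Analysis.FunctionSpaces Literature.Analysis.FluidPDE

namespace TopEig

open StrainL4 StrainTensor

variable {d : Type*} [Fintype d] [DecidableEq d] [Nonempty d]

/-! ## 1. Homogeneity of the Euler strain tendency, of heat-maximal selections and of `𝒫_q` -/

omit [Nonempty d] in
/-- **The Euler strain tendency is quadratic along amplitude rays**: `E_{a w} = a² E_w` for smooth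
`w` (pressure `π_{a w} = a² π_w`, `N(a w) = a² N(w)`, transport `a²`). [ours, bookkeeping] -/
theorem eulerStrainVec_smul {w : UnitAddTorus d → EuclideanSpace ℝ d} (hw : Torus.IsSmooth w)
    (a : ℝ) (x : UnitAddTorus d) : eulerStrainVec (a • w) x = (a ^ 2) • eulerStrainVec w x := by
  unfold eulerStrainVec
  rw [pressureOf_smul hw a, pressVec_const_smul (isSmooth_pressureOf hw) (a ^ 2) x,
    nonlinVec_smul (hw.isContDiff (by simp)) a x, transport_smul hw a x, smul_sub, smul_sub, smul_neg]

/-- **Heat-maximal top selections are preserved by positive amplitude scaling**: a heat-maximal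
selection for `w` is one for `a • w`, `a > 0` (`S(a w) = a S(w)`, `S(Δ(a w)) = a S(Δw)`; the top
eigen-set and `μ(·; M)` ignore the factor, the heat form and `μ(A; ·)` are linear in it).
[ours, bookkeeping] -/
theorem IsHeatMaxSelection.smul {w : UnitAddTorus d → EuclideanSpace ℝ d} {e : UnitAddTorus d → d → ℝ}
    (he : IsHeatMaxSelection w e) {a : ℝ} (ha : 0 < a) (hw : Torus.IsSmooth w) :
    IsHeatMaxSelection (a • w) e where
  top x := by
    rw [strainFlat_smul (hw.isContDiff (by simp)) a x, topEigSet_smul_of_pos ha]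
    exact he.top x
  heat x := by
    rw [laplacian_smul_of_isSmooth hw a, strainFlat_smul (hw.laplacian.isContDiff (by simp)) a x,
      strainFlat_smul (hw.isContDiff (by simp)) a x, quad_smul, dirTopEig_smul_left_of_pos ha,
      dirTopEig_smul_of_nonneg ha.le, he.heat x]

/-- The selection production density scales like `a^{q+1}` (`a > 0`, smooth divergence-free `w`):
`q λ₁(a w)^{q−1} eᵀE_{a w}e = a^{q+1} · q λ₁(w)^{q−1} eᵀE_we`. [ours, bookkeeping] -/
theorem selDensity_smul {q a : ℝ} (ha : 0 < a) {w : UnitAddTorus d → EuclideanSpace ℝ d}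
    (hw : Torus.IsSmooth w) (hdw : Torus.IsDivFree w) (e : UnitAddTorus d → d → ℝ)
    (x : UnitAddTorus d) :
    q * torusStrainTopEig (a • w) x ^ (q - 1) * quad (eulerStrainVec (a • w) x) (e x) =
      a ^ (q + 1) * (q * torusStrainTopEig w x ^ (q - 1) * quad (eulerStrainVec w x) (e x)) := by
  rw [rpow_torusStrainTopEig_smul ha.le hw hdw (q - 1) x, eulerStrainVec_smul hw a x, quad_smul]
  have h : a ^ (q - 1) * a ^ 2 = a ^ (q + 1) := by
    rw [← Real.rpow_two, ← Real.rpow_add ha]; congr 1; ring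
  linear_combination (q * torusStrainTopEig w x ^ (q - 1) * quad (eulerStrainVec w x) (e x)) * h

/-- Integrability of the production density is preserved by positive amplitude scaling.
[ours, bookkeeping] -/
theorem integrable_selDensity_smul {q a : ℝ} (ha : 0 < a) {w : UnitAddTorus d → EuclideanSpace ℝ d}
    (hw : Torus.IsSmooth w) (hdw : Torus.IsDivFree w) {e : UnitAddTorus d → d → ℝ}
    (hint : Integrable (fun x => q * torusStrainTopEig w x ^ (q - 1) *
      quad (eulerStrainVec w x) (e x)) volume) :
    Integrable (fun x => q * torusStrainTopEig (a • w) x ^ (q - 1) *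
      quad (eulerStrainVec (a • w) x) (e x)) volume := by
  have h : (fun x => q * torusStrainTopEig (a • w) x ^ (q - 1) * quad (eulerStrainVec (a • w) x) (e x)) =
      fun x => a ^ (q + 1) * (q * torusStrainTopEig w x ^ (q - 1) * quad (eulerStrainVec w x) (e x)) :=
    funext fun x => selDensity_smul ha hw hdw e x
  rw [h]
  exact hint.const_mul _

/-- **The selection production is `(q+1)`-homogeneous**: `𝒫_q(a w; e) = a^{q+1} 𝒫_q(w; e)` for
`a > 0` and smooth divergence-free `w`. [ours, bookkeeping] -/
theorem selEulerProduction_smul (q : ℝ) {a : ℝ} (ha : 0 < a)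
    {w : UnitAddTorus d → EuclideanSpace ℝ d} (hw : Torus.IsSmooth w) (hdw : Torus.IsDivFree w)
    (e : UnitAddTorus d → d → ℝ) :
    selEulerProduction q (a • w) e = a ^ (q + 1) * selEulerProduction q w e := by
  unfold selEulerProduction
  rw [← integral_const_mul]
  exact integral_congr_ae (ae_of_all _ fun x => selDensity_smul ha hw hdw e x)

end TopEig

/-! ## 2. The static door at a FIXED viscosity, and LEMMA K in scaling form -/

open TopEig

variable {d : Type*} [Fintype d] [DecidableEq d]

/-- **The static door at one constant AND one viscosity** (`λ₁` rows): at the GIVEN `ν`, ONE smooth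
divergence-free zero-mean datum `w` on `T³` and ONE heat-maximal selection `e` (integrable production
density) with `κ ν^{−γ} (2ℰ w) Φ_q(w)^{1+1/σ} < 𝒫_q(w; e) − ν · heatDissipation Φ_q w` (the body of
`TopEigSelKillAt` with `ν` fixed). Search for candidate a priori estimates; no regularity claim —
nothing is asserted. [ours, bookkeeping] -/
def TopEigSelKillAtNu (q σ γ κ ν : ℝ) : Prop :=
  ∃ w : UnitAddTorus (Fin 3) → EuclideanSpace ℝ (Fin 3),
    Torus.IsSmooth w ∧ Torus.IsDivFree w ∧ Torus.HasZeroMean w ∧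
    ∃ e : UnitAddTorus (Fin 3) → Fin 3 → ℝ, IsHeatMaxSelection w e ∧
      Integrable (fun x => q * torusStrainTopEig w x ^ (q - 1) * quad (eulerStrainVec w x) (e x)) volume ∧
      κ * ν ^ (-γ) * (2 * torusEnstrophy w) * torusTopEigMoment q w ^ (1 + σ⁻¹) <
        selEulerProduction q w e - ν * heatDissipation (torusTopEigMoment q) w

/-- `TopEigSelKillAt` is the door at SOME viscosity `ν > 0`. [ours, bookkeeping] -/
theorem topEigSelKillAt_iff_exists_atNu {q σ γ κ : ℝ} :
    TopEigSelKillAt q σ γ κ ↔ ∃ ν : ℝ, 0 < ν ∧ TopEigSelKillAtNu q σ γ κ ν :=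
  Iff.rfl

/-- The fixed-viscosity door at some `ν > 0` opens the door `TopEigSelKillAt`. [ours, bookkeeping] -/
theorem topEigSelKillAt_of_atNu {q σ γ κ ν : ℝ} (hν : 0 < ν) (h : TopEigSelKillAtNu q σ γ κ ν) :
    TopEigSelKillAt q σ γ κ :=
  ⟨ν, hν, h⟩

section LemmaKScaling

variable {ι : Type*}

/-- **LEMMA K for the `λ₁` rows, SCALING form (fixed viscosity).** `1 + q/σ > 0`; an indexed family of
smooth divergence-free zero-mean data `w i` on `T³` with heat-maximal selections `e i` (integrable
production densities), (K-a) a production floor `0 < c ≤ 𝒫_q(w i; e i)`, (K-b) bounded budgets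
`(2ℰ(w i)) Φ_q(w i)^{1+1/σ} ≤ B`, (K-c) heat costs `heatDissipation Φ_q (w i) ≤ ε` available for every
`ε > 0`. Then for EVERY real `κ` and EVERY `ν > 0` the fixed-viscosity door `TopEigSelKillAtNu q σ γ κ ν`
is open — at the datum `a • w i` with the amplitude `a ∈ (0, 1]` of `exists_scale_budget_lt_of_family`
(exponent gap `θ = 1 + q/σ`, constant `K = κ ν^{−γ}`) chosen BEFORE the member `i`. No sign condition
on `γ`. Search for candidate a priori estimates; no regularity claim — (K-a)–(K-c) are what a pen
witness family must supply; none is exhibited. [ours; QN4-NOTE LEMMA K, scaling form] -/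
theorem topEigSelKillAtNu_of_family {q σ γ c B : ℝ} (hθ : 0 < 1 + σ⁻¹ * q) (hc : 0 < c)
    {w : ι → UnitAddTorus (Fin 3) → EuclideanSpace ℝ (Fin 3)} {e : ι → UnitAddTorus (Fin 3) → Fin 3 → ℝ}
    (hw : ∀ i, Torus.IsSmooth (w i)) (hdw : ∀ i, Torus.IsDivFree (w i))
    (hmean : ∀ i, Torus.HasZeroMean (w i)) (he : ∀ i, IsHeatMaxSelection (w i) (e i))
    (hint : ∀ i, Integrable (fun x => q * torusStrainTopEig (w i) x ^ (q - 1) *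
      quad (eulerStrainVec (w i) x) (e i x)) volume)
    (hprod : ∀ i, c ≤ selEulerProduction q (w i) (e i))
    (hbud : ∀ i, 2 * torusEnstrophy (w i) * torusTopEigMoment q (w i) ^ (1 + σ⁻¹) ≤ B)
    (hheat : ∀ ε : ℝ, 0 < ε → ∃ i, heatDissipation (torusTopEigMoment q) (w i) ≤ ε)
    (κ : ℝ) {ν : ℝ} (hν : 0 < ν) : TopEigSelKillAtNu q σ γ κ ν := by
  obtain ⟨a, ha, -, i, hlt⟩ := exists_scale_budget_lt_of_family (K := κ * ν ^ (-γ)) hθ hc hν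
    (b := fun i => 2 * torusEnstrophy (w i) * torusTopEigMoment q (w i) ^ (1 + σ⁻¹))
    (P := fun i => selEulerProduction q (w i) (e i))
    (H := fun i => heatDissipation (torusTopEigMoment q) (w i))
    (fun i => mul_nonneg (mul_nonneg two_pos.le (torusEnstrophy_nonneg _))
      (Real.rpow_nonneg (torusTopEigMoment_nonneg q _) _)) hbud hprod hheat
  refine ⟨a • w i, (hw i).smul a, isDivFree_const_smul ((hw i).isContDiff (by simp)) (hdw i) a,
    hasZeroMean_const_smul (hmean i) a, e i, (he i).smul ha (hw i),
    integrable_selDensity_smul ha (hw i) (hdw i) (hint i), ?_⟩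
  rw [mul_assoc (κ * ν ^ (-γ)), enstrophy_topEigMoment_budget_smul q σ ha (hw i),
    selEulerProduction_smul q ha (hw i) (hdw i) (e i), heatDissipation_topEigMoment_smul q ha (hw i)]
  have h1 : a ^ (2 + q * (1 + σ⁻¹)) = a ^ (q + 1) * a ^ (1 + σ⁻¹ * q) := by
    rw [← Real.rpow_add ha]; congr 1; ring
  have h2 : a ^ q = a ^ (q + 1) * a⁻¹ := by
    rw [← Real.rpow_neg_one, ← Real.rpow_add ha]; congr 1; ring
  rw [h1, h2]
  have hpos : 0 < a ^ (q + 1) := Real.rpow_pos_of_pos ha _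
  have key := mul_lt_mul_of_pos_left hlt hpos
  linarith [key]

/-- **LEMMA K (scaling form) gives the door for every constant** without a sign condition on `γ`:
under the hypotheses of `topEigSelKillAtNu_of_family`, `TopEigSelKill q σ γ` (at `ν = 1`, say).
Nothing is exhibited. [ours] -/
theorem topEigSelKill_of_family_of_scaling {q σ γ c B : ℝ} (hθ : 0 < 1 + σ⁻¹ * q) (hc : 0 < c)
    {w : ι → UnitAddTorus (Fin 3) → EuclideanSpace ℝ (Fin 3)} {e : ι → UnitAddTorus (Fin 3) → Fin 3 → ℝ}
    (hw : ∀ i, Torus.IsSmooth (w i)) (hdw : ∀ i, Torus.IsDivFree (w i))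
    (hmean : ∀ i, Torus.HasZeroMean (w i)) (he : ∀ i, IsHeatMaxSelection (w i) (e i))
    (hint : ∀ i, Integrable (fun x => q * torusStrainTopEig (w i) x ^ (q - 1) *
      quad (eulerStrainVec (w i) x) (e i x)) volume)
    (hprod : ∀ i, c ≤ selEulerProduction q (w i) (e i))
    (hbud : ∀ i, 2 * torusEnstrophy (w i) * torusTopEigMoment q (w i) ^ (1 + σ⁻¹) ≤ B)
    (hheat : ∀ ε : ℝ, 0 < ε → ∃ i, heatDissipation (torusTopEigMoment q) (w i) ≤ ε) :
    TopEigSelKill q σ γ := fun κ =>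
  topEigSelKillAt_of_atNu one_pos
    (topEigSelKillAtNu_of_family hθ hc hw hdw hmean he hint hprod hbud hheat κ one_pos)

end LemmaKScaling

/-! ## 3. Lemma 0 (⇒) at one viscosity for the `λ₁` rows, and the kill at EVERY fixed viscosity -/

/-- **The static necessary condition for the `λ₁` rows at ONE viscosity.** Under
`SaturatingLawSupAt ν Φ_q σ γ κ` on `T³` (`q ≥ 1`, `ν > 0`): at every smooth divergence-free zero-mean
datum `w` and every heat-maximal selection `e` with integrable production density,
`𝒫_q(w; e) − ν · heatDissipation Φ_q w ≤ κ ν^{−γ} (2ℰ w) Φ_q(w)^{1+1/σ}`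
(`SaturatingLawSupAt.lowerRate_le` + LEMMA S, `TopEig.selEulerProduction_sub_heat_le_initialRate`).
[ours; SIEVELD §0 Lemma 0 (⇒) + QN4-NOTE LEMMA S, `ν` fixed] -/
theorem SaturatingLawSupAt.selEulerProduction_sub_heat_le {q σ γ κ ν : ℝ} (hq : 1 ≤ q)
    (hd : Fintype.card d = 3)
    (h : SaturatingLawSupAt (d := d) ν (torusTopEigMoment q) σ γ κ) (hν : 0 < ν)
    {w : UnitAddTorus d → EuclideanSpace ℝ d} (hw : Torus.IsSmooth w) (hdw : Torus.IsDivFree w)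
    (hmean : Torus.HasZeroMean w) {e : UnitAddTorus d → d → ℝ} (he : IsHeatMaxSelection w e)
    (hint : Integrable (fun x => q * torusStrainTopEig w x ^ (q - 1) *
      quad (eulerStrainVec w x) (e x)) volume) :
    selEulerProduction q w e - ν * heatDissipation (torusTopEigMoment q) w ≤
      κ * ν ^ (-γ) * (2 * torusEnstrophy w) * torusTopEigMoment q w ^ (1 + σ⁻¹) := by
  haveI : Nonempty d := Fintype.card_pos_iff.1 (by omega)
  refine h.lowerRate_le hd hν hw hdw hmean fun T hT u p hsol hu0 _ => ?_
  subst hu0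
  exact selEulerProduction_sub_heat_le_initialRate hq hT hsol he hint

/-- **Fixed-viscosity door ⇒ kill at that viscosity**:
`TopEigSelKillAtNu q σ γ κ ν → ¬ SaturatingLawSupAt ν Φ_q σ γ κ` on `T³` (`q ≥ 1`, `ν > 0`).
Refutation bookkeeping for a CANDIDATE inequality; nothing about regularity. [ours] -/
theorem not_topEigMoment_saturatingLawSupAt_of_selKillAtNu {q σ γ κ ν : ℝ} (hq : 1 ≤ q)
    (hν : 0 < ν) (hK : TopEigSelKillAtNu q σ γ κ ν) :
    ¬ SaturatingLawSupAt (d := Fin 3) ν (torusTopEigMoment q) σ γ κ := by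
  intro hlaw
  obtain ⟨w, hw, hdw, hmean, e, he, hint, hlt⟩ := hK
  exact (not_le.2 hlt) (hlaw.selEulerProduction_sub_heat_le hq (by simp) hν hw hdw hmean he hint)

section LemmaKScaling

variable {ι : Type*}

/-- **A family kills the `λ₁` law at EVERY FIXED viscosity and EVERY constant** (the `ν`-wise
statement of the pen LEMMA K / THEOREM Q-N4 (W2)): under the hypotheses of
`topEigSelKillAtNu_of_family` (`1 + q/σ > 0`, (K-a)–(K-c)) and `q ≥ 1`,
`¬ SaturatingLawSupAt ν Φ_q σ γ κ` on `T³` for every real `κ` and every `ν > 0`. Refutation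
bookkeeping for a CANDIDATE inequality; nothing about regularity; no family is exhibited. [ours] -/
theorem not_topEigMoment_saturatingLawSupAt_of_family {q σ γ c B : ℝ} (hq : 1 ≤ q)
    (hθ : 0 < 1 + σ⁻¹ * q) (hc : 0 < c)
    {w : ι → UnitAddTorus (Fin 3) → EuclideanSpace ℝ (Fin 3)} {e : ι → UnitAddTorus (Fin 3) → Fin 3 → ℝ}
    (hw : ∀ i, Torus.IsSmooth (w i)) (hdw : ∀ i, Torus.IsDivFree (w i))
    (hmean : ∀ i, Torus.HasZeroMean (w i)) (he : ∀ i, IsHeatMaxSelection (w i) (e i))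
    (hint : ∀ i, Integrable (fun x => q * torusStrainTopEig (w i) x ^ (q - 1) *
      quad (eulerStrainVec (w i) x) (e i x)) volume)
    (hprod : ∀ i, c ≤ selEulerProduction q (w i) (e i))
    (hbud : ∀ i, 2 * torusEnstrophy (w i) * torusTopEigMoment q (w i) ^ (1 + σ⁻¹) ≤ B)
    (hheat : ∀ ε : ℝ, 0 < ε → ∃ i, heatDissipation (torusTopEigMoment q) (w i) ≤ ε)
    (κ : ℝ) {ν : ℝ} (hν : 0 < ν) :
    ¬ SaturatingLawSupAt (d := Fin 3) ν (torusTopEigMoment q) σ γ κ :=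
  not_topEigMoment_saturatingLawSupAt_of_selKillAtNu hq hν
    (topEigSelKillAtNu_of_family hθ hc hw hdw hmean he hint hprod hbud hheat κ hν)

/-- **A family kills the `λ₁` law for every constant, scaling form** (no sign condition on `γ`):
under the hypotheses of `topEigSelKillAtNu_of_family` and `q ≥ 1`, `¬ SaturatingLawSup Φ_q σ γ κ` on
`T³` for EVERY real `κ`. Compare `not_topEigMoment_saturatingLawSup_of_family` (large viscosity,
`γ > 0`, no condition on `q/σ`). Nothing is exhibited. [ours] -/
theorem not_topEigMoment_saturatingLawSup_of_family_of_scaling {q σ γ c B : ℝ} (hq : 1 ≤ q)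
    (hθ : 0 < 1 + σ⁻¹ * q) (hc : 0 < c)
    {w : ι → UnitAddTorus (Fin 3) → EuclideanSpace ℝ (Fin 3)} {e : ι → UnitAddTorus (Fin 3) → Fin 3 → ℝ}
    (hw : ∀ i, Torus.IsSmooth (w i)) (hdw : ∀ i, Torus.IsDivFree (w i))
    (hmean : ∀ i, Torus.HasZeroMean (w i)) (he : ∀ i, IsHeatMaxSelection (w i) (e i))
    (hint : ∀ i, Integrable (fun x => q * torusStrainTopEig (w i) x ^ (q - 1) *
      quad (eulerStrainVec (w i) x) (e i x)) volume)
    (hprod : ∀ i, c ≤ selEulerProduction q (w i) (e i))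
    (hbud : ∀ i, 2 * torusEnstrophy (w i) * torusTopEigMoment q (w i) ^ (1 + σ⁻¹) ≤ B)
    (hheat : ∀ ε : ℝ, 0 < ε → ∃ i, heatDissipation (torusTopEigMoment q) (w i) ≤ ε) (κ : ℝ) :
    ¬ SaturatingLawSup (d := Fin 3) (torusTopEigMoment q) σ γ κ :=
  not_topEigMoment_saturatingLawSup_of_selKill hq
    (topEigSelKill_of_family_of_scaling hθ hc hw hdw hmean he hint hprod hbud hheat) κ

end LemmaKScaling

end Summit.NavierStokesRegularity.FunctionalMining

end
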